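import Mathlib
import Summits.ResolutionOfSingularities.ResolutionOfSingularities.Theorems.WeightedInvariantLocalWeightedDropNCResSettingPermissible
import Summits.ResolutionOfSingularities.ResolutionOfSingularities.Theorems.WeightedInvariantLocalWeightedDropWildMonicWideExit

/-!
# `WeightedInvariant.LocalWeightedDrop`, TOT2-LINE piece S-E2 (count-game bridge), item (c5-curve): THE CURVE MOVE `V(x_i, y)` OF A PRESENTED
# DECORATED STATE IS B-PERMISSIBLE

Crux item stmt-ResolutionOfSingularities-8899 `LocalWeightedDrop` (route `ResolutionOfSingularities/WeightedInvariant`), ENGINE skeleton v32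
(ddb48572591139d5), registered stub `stub_spaceNCRankDrop`; TOT2-LINE v1.2 (`L/res-L1-w43-lead-1/g4/TOT2-LINE.md`), the item «(c5-curve)» left open
by res-L1-w43-stub-2's …TOT2BridgeDecorated (13:21Z hand-over to S-ASM).  [OURS · L1 W4.3 · chain w43 · res-L1-w43-lead-1 gen 4, on
res-L1-w43-stub-1's S-SET (…NCResSettingPermissible `isBPermissible_iff_totalO`, the I₃-device) and res-type-083's monic forms (`order_monicForm_le`).
Nothing here is a statement of any manuscript; AI-produced, gate-checked, weaker than expert review.  Definition-free.]

If a decorated state `δ` is PRESENTED by a legal, boundary-straightening `Φ₀` (B-permissible for the point centre) as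
`(f · ∏_{l∈O} x_l) ∘ Φ₀ = U · (y^d + Σ_j A_j y^j)` with `U(0) ≠ 0` and `A_j = x_i^{d−j} · A′_j` (the curve `V(x_i, y)` is permissible for the monic
form), then the count move `(Φ₀, 𝟙_{x_i, y})` — the blow-up of `V(x_i, y)` in the presenting coordinates — is B-PERMISSIBLE for `δ`: the product
`U · P` has order `≤ d` (the `y^d`-coefficient) and weighted order `≥ d` (every monomial of `P` has `x_i`-degree plus `y`-degree `≥ d`).

* `le_weightedOrder_sum` — a Finset sum has weighted order at least a common lower bound of its terms;
* `weightedOrder_monicForm_ge` — `A_j = x_i^{d−j} A′_j` for all `j` ⇒ `d ≤ weightedOrder_{𝟙_{x_i,y}} (y^d + Σ A_j y^j)` (every `m`);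
* **`isBPermissible_curve_of_presentation`** — the statement above (every `m`, every field).
-/

set_option linter.dupNamespace false -- mandated namespace of this single-conjunct summit

noncomputable section

namespace Summit.ResolutionOfSingularities.ResolutionOfSingularities.Theorems

namespace TameFourTupleDrop

open MvPowerSeries Literature.AlgebraicGeometry.Resolution

variable {k : Type} [Field k] {m : ℕ}

/-- A Finset sum has weighted order at least any common lower bound of the weighted orders of its terms. -/
theorem le_weightedOrder_sum {σ : Type*} (w : σ → ℕ) {ι : Type*} (s : Finset ι) (g : ι → MvPowerSeries σ k) {n : ℕ∞}
    (h : ∀ j ∈ s, n ≤ (g j).weightedOrder w) : n ≤ (∑ j ∈ s, g j).weightedOrder w := by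
  classical
  induction s using Finset.induction_on with
  | empty => rw [Finset.sum_empty, weightedOrder_zero]; exact le_top
  | insert a s ha ih =>
    rw [Finset.sum_insert ha]
    exact le_trans (le_min (h a (Finset.mem_insert_self a s)) (ih fun j hj => h j (Finset.mem_insert_of_mem hj)))
      (min_weightedOrder_le_add w)

/-- The weighted order of a letter for the curve weights `𝟙_{x_i, y}`: `1` on `x_i` and `y`. -/
theorem weightedOrder_X_curveWt (i : Fin m) (l : Fin (m + 1)) :
    (X l : MvPowerSeries (Fin (m + 1)) k).weightedOrder (fun l : Fin (m + 1) => if l = Fin.castSucc i ∨ l = Fin.last m then (1 : ℕ) else 0) =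
      if l = Fin.castSucc i ∨ l = Fin.last m then (1 : ℕ∞) else 0 := by
  rw [X_def, weightedOrder_monomial_of_ne_zero (w := fun l : Fin (m + 1) => if l = Fin.castSucc i ∨ l = Fin.last m then (1 : ℕ) else 0)
    (one_ne_zero' k), Finsupp.weight_single]
  split_ifs <;> simp

/-- **`V(x_i, y)`-PERMISSIBLE MONIC FORMS HAVE WEIGHTED ORDER `≥ d`** for the curve weights `𝟙_{x_i, y}`: if `A_j = x_i^{d−j} · A′_j` for every `j`,
every monomial of `y^d + Σ_j A_j y^j` has `x_i`-degree plus `y`-degree at least `d`. -/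
theorem weightedOrder_monicForm_ge (i : Fin m) {d : ℕ} (A A' : Fin d → MvPowerSeries (Fin m) k) (hdiv : ∀ j, A j = X i ^ (d - (j : ℕ)) * A' j) :
    (d : ℕ∞) ≤ (X (Fin.last m) ^ d + ∑ j : Fin d, rename (Fin.succAboveEmb (Fin.last m)) (A j) * X (Fin.last m) ^ (j : ℕ)).weightedOrder
      (fun l : Fin (m + 1) => if l = Fin.castSucc i ∨ l = Fin.last m then (1 : ℕ) else 0) := by
  set w : Fin (m + 1) → ℕ := fun l => if l = Fin.castSucc i ∨ l = Fin.last m then (1 : ℕ) else 0 with hw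
  have hY : (X (Fin.last m) : MvPowerSeries (Fin (m + 1)) k).weightedOrder w = 1 := by
    rw [hw, weightedOrder_X_curveWt]; exact if_pos (Or.inr rfl)
  have hXi : (X (Fin.castSucc i) : MvPowerSeries (Fin (m + 1)) k).weightedOrder w = 1 := by
    rw [hw, weightedOrder_X_curveWt]; exact if_pos (Or.inl rfl)
  have hYpow : ∀ n : ℕ, (n : ℕ∞) ≤ ((X (Fin.last m) : MvPowerSeries (Fin (m + 1)) k) ^ n).weightedOrder w := fun n => by
    have h := le_weightedOrder_pow (w := w) (f := (X (Fin.last m) : MvPowerSeries (Fin (m + 1)) k)) n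
    rwa [hY, nsmul_one] at h
  have hXpow : ∀ n : ℕ, (n : ℕ∞) ≤ ((X (Fin.castSucc i) : MvPowerSeries (Fin (m + 1)) k) ^ n).weightedOrder w := fun n => by
    have h := le_weightedOrder_pow (w := w) (f := (X (Fin.castSucc i) : MvPowerSeries (Fin (m + 1)) k)) n
    rwa [hXi, nsmul_one] at h
  have hemb : (Fin.succAboveEmb (Fin.last m)) i = Fin.castSucc i := by
    rw [Fin.coe_succAboveEmb, Fin.succAbove_last]
  refine le_trans (le_min (hYpow d) (le_weightedOrder_sum w _ _ fun j _ => ?_)) (min_weightedOrder_le_add w)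
  -- the term `rename (A_j) · y^j = x_i^{d−j} · rename (A′_j) · y^j`
  rw [hdiv j, map_mul, map_pow, rename_X, hemb]
  have hj : ((d - (j : ℕ) : ℕ) : ℕ∞) + (j : ℕ) = d := by
    rw [← Nat.cast_add, Nat.sub_add_cancel j.2.le]
  calc (d : ℕ∞) = ((d - (j : ℕ) : ℕ) : ℕ∞) + 0 + (j : ℕ) := by rw [add_zero, hj]
    _ ≤ ((X (Fin.castSucc i) : MvPowerSeries (Fin (m + 1)) k) ^ (d - (j : ℕ))).weightedOrder w +
          (rename (Fin.succAboveEmb (Fin.last m)) (A' j)).weightedOrder w +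
          ((X (Fin.last m) : MvPowerSeries (Fin (m + 1)) k) ^ (j : ℕ)).weightedOrder w :=
        add_le_add (add_le_add (hXpow _) bot_le) (hYpow _)
    _ ≤ _ := le_trans (add_le_add (le_weightedOrder_mul w) le_rfl) (le_weightedOrder_mul w)

/-- A unit has order `0`. -/
theorem order_eq_zero_of_constantCoeff_ne_zero {n : ℕ} {U : MvPowerSeries (Fin n) k} (hU : constantCoeff U ≠ 0) : U.order = 0 := by
  have h := order_le (f := U) (d := 0) (by rwa [coeff_zero_eq_constantCoeff])
  rw [map_zero, Nat.cast_zero] at h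
  exact le_antisymm h bot_le

/-- **(c5-curve) THE CURVE MOVE OF A PRESENTED DECORATED STATE IS B-PERMISSIBLE.**  Let `(Φ₀, 𝟙)` be B-permissible for `δ` (a legal change
straightening the boundary letters), `f ≠ 0`, and `(f · ∏_{l∈O} x_l) ∘ Φ₀ = U · (y^d + Σ_j A_j y^j)` with `U(0) ≠ 0` and `A_j = x_i^{d−j} · A′_j`.
Then `(Φ₀, 𝟙_{x_i, y})` — the blow-up of the curve `V(x_i, y)` of the presenting coordinates — is B-permissible for `δ`
(via the I₃-device `isBPermissible_iff_totalO`: `ord (U·P) ≤ d ≤ weightedOrder (U·P)`). -/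
theorem isBPermissible_curve_of_presentation {δ : Decoration k m} {Φ₀ : Fin (m + 1) → MvPowerSeries (Fin (m + 1)) k}
    (hperm : IsBPermissible δ Φ₀ (fun _ => 1)) (hf : δ.f ≠ 0) {d : ℕ} {A A' : Fin d → MvPowerSeries (Fin m) k} (i : Fin m)
    (hdiv : ∀ j, A j = X i ^ (d - (j : ℕ)) * A' j) {U : MvPowerSeries (Fin (m + 1)) k} (hU : constantCoeff U ≠ 0)
    (hP : subst Φ₀ (δ.f * ∏ l ∈ δ.O, X l) =
      U * (X (Fin.last m) ^ d + ∑ j : Fin d, rename (Fin.succAboveEmb (Fin.last m)) (A j) * X (Fin.last m) ^ (j : ℕ))) :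
    IsBPermissible δ Φ₀ (fun l : Fin (m + 1) => if l = Fin.castSucc i ∨ l = Fin.last m then (1 : ℕ) else 0) := by
  obtain ⟨hmv1, -, -, hP3⟩ := hperm
  have hmv : IsCountMove Φ₀ (fun l : Fin (m + 1) => if l = Fin.castSucc i ∨ l = Fin.last m then (1 : ℕ) else 0) := by
    refine ⟨hmv1.1, hmv1.2.1, fun l => ?_, Fin.last m, ?_⟩
    · dsimp only; split_ifs <;> simp
    · dsimp only; rw [if_pos (Or.inr rfl)]; exact Nat.one_pos
  rw [isBPermissible_iff_totalO hmv hf hP3, hP, order_mul, order_eq_zero_of_constantCoeff_ne_zero hU, zero_add]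
  refine le_trans (WildMonic.order_monicForm_le A) (le_trans ?_ (le_weightedOrder_mul _))
  exact le_trans (weightedOrder_monicForm_ge i A A' hdiv) le_add_self

end TameFourTupleDrop

end Summit.ResolutionOfSingularities.ResolutionOfSingularities.Theorems

end
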